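import Summits.KontsevichZagierPeriods.KontsevichZagierPeriods.Theses.AyoubSpecialisation
import Summits.KontsevichZagierPeriods.KontsevichZagierPeriods.Theorems.UnfoldedStokesStokesGenerationStubCubeCalibration

/-!
# `AyoubRelACubeCalibration` (stmt-KontsevichZagierPeriods-0543, route AyoubSpecialisation) — proved

The calibration of Kontsevich–Zagier's four-move calculus against Ayoub's cube presentation
[Ayoub 2014, Def. 10]: for `G` `C¹` and `ℚ`-semialgebraic on an open `U ⊇ [0,1]ᵐ` and EVERY
coordinate `i`, the closed-cube representation with integrand `∂G/∂xᵢ − G|_{xᵢ=1} + G|_{xᵢ=0}`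
(Ayoub's type-(a) generator) lies in `KZ.relations`. This is exactly the landed stub
`StokesGenerationLine.stub_cubeCalibration` of crux `StokesGeneration` (line `Sketch`,
`Theorems/UnfoldedStokesStokesGenerationStubCubeCalibration.lean`: coordinate transposition by rule
(2), Newton–Leibniz along the last coordinate by rule (3), re-inflation of the two restriction terms
by rule (3), integrand additivity); the item's two Tarski–Seidenberg antecedents
(`IsSemialgebraicFunOn.add/mul`, discharged in the tree) are not needed.
-/

noncomputable section

-- `Summit.KontsevichZagierPeriods.KontsevichZagierPeriods.…` is the tree's mandated layout (single-conjunct summit).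
set_option linter.dupNamespace false

namespace Summit.KontsevichZagierPeriods.KontsevichZagierPeriods.AyoubSpecialisationCalibration

/-- **Ayoub's type-(a) generator is a relation of the four-move calculus, for every coordinate**
(item `AyoubRelACubeCalibration`, stmt-KontsevichZagierPeriods-0543).
[cite: Ayoub2014, Def. 10] [cite: KontsevichZagier2001, §1.2] -/
theorem ayoubRelACubeCalibration_proof :
    Summit.KontsevichZagierPeriods.KontsevichZagierPeriods.Theses.AyoubSpecialisation.AyoubRelACubeCalibration :=
  fun _ _ => Summit.KontsevichZagierPeriods.KontsevichZagierPeriods.StokesGenerationLine.stub_cubeCalibration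

end Summit.KontsevichZagierPeriods.KontsevichZagierPeriods.AyoubSpecialisationCalibration
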